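import Summits.ResolutionOfSingularities.KangarooAtlas.PointBlowupLayerFormula

/-!
# The layer formula for the shade after a point blow-up (cell pub-rosobs, carver g16) — part 2: CLAIM 3 and CLAIM 2

Continuation of `PointBlowupLayerFormula` (same namespace, same variables; split only for the 400-line module limit):
the proof that the layer-0 value is Hauser–Perlega's condition (4) (`layerZeroIsCondition4Claim_holds`, CLAIM 3) and the
kangaroo criterion (`kangarooCriterionClaim_holds`, CLAIM 2, a formal consequence of CLAIM 1 proved in part 1).
Statements, proofs and comments below are the staged file's lines 340–674 verbatim (one docstring added).
-/

open MvPolynomial Finset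
open scoped BigOperators

namespace Summit.ResolutionOfSingularities.KangarooAtlas.PointBlowup

open Literature.AlgebraicGeometry.Resolution
open Literature.AlgebraicGeometry.Resolution.Hauser2010
open Literature.AlgebraicGeometry.Resolution.PointBlowup

variable {σ : Type*} {K : Type*} [Field K] [Fintype σ] [DecidableEq σ] [DecidableEq K]
/-! ### Proof of CLAIM 3: the layer-0 value is Hauser–Perlega's condition (4)

The translated chart transform of the initial form `In F` (layer `0`, `y_j`-exponent `o − q`) and the
sheared initial form `shear_{j,b}(In F)` (homogeneous of degree `o`) have the same monomials off `y_j`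
with the same coefficients — both dehomogenise to `Φ_{j,b}(In F)` — and a monomial of either is a
`q`-th power iff its exponents off `y_j` are divisible by `q` and `q ∣ o`. The first three private
lemmas are verbatim copies of private lemmas of `CentreBlowupResidueInequality.lean` §1 (cell
pub-hironaka), reproduced because they are not exported. -/

section LayerZero

omit [DecidableEq K] in
/-- (copy) The shear preserves homogeneity. -/
private theorem degree_eq_of_mem_support_shear (j : σ) (t : σ → K) (P : MvPolynomial σ K) {o : ℕ}
    (hP : ∀ d ∈ P.support, d.degree = o) :
    ∀ E ∈ (shear j t P).support, E.degree = o := by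
  classical
  unfold shear
  conv => enter [E, 1]; rw [P.as_sum, map_sum]
  refine forall_support_sum _ _ fun d hd => ?_
  rw [aeval_monomial, algebraMap_eq, Finsupp.prod_pow]
  have hfac : ∀ i ∈ (univ : Finset σ), ∀ m ∈ ((if i = j then (X j : MvPolynomial σ K)
      else X i + C (t i) * X j) ^ (d i)).support, m.degree = d i := by
    intro i _
    have h1 : ∀ m ∈ (if i = j then (X j : MvPolynomial σ K) else X i + C (t i) * X j).support,
        m.degree = 1 := by
      split_ifs
      · exact forall_support_X (P := fun m => m.degree = 1) (Finsupp.degree_single _ _)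
      · refine forall_support_add (forall_support_X (P := fun m => m.degree = 1)
          (Finsupp.degree_single _ _)) ?_
        rw [← monomial_zero', X, monomial_mul, zero_add, mul_one]
        exact forall_support_monomial (P := fun m => m.degree = 1) (Finsupp.degree_single _ _) _
    have := forall_support_pow (P := fun n m => m.degree = n) (n := 1) (by rw [map_zero])
      (fun _ _ a c ha hc => by rw [map_add, ha, hc]) h1 (d i)
    rwa [mul_one] at this
  have hprod := forall_support_prod (P := fun n m => m.degree = n) (by rw [map_zero])
    (fun _ _ a c ha hc => by rw [map_add, ha, hc]) univ _ (fun i => d i) hfac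
  have hC : ∀ m ∈ (C (coeff d P) : MvPolynomial σ K).support, m.degree = 0 :=
    forall_support_C (P := fun m => m.degree = 0) (by rw [map_zero]) _
  refine forall_support_mul (P := fun m => m.degree = 0) (Q := fun m => m.degree = ∑ i, d i)
    (S := fun m => m.degree = o) (fun a c ha hc => ?_) hC hprod
  rw [map_add, ha, hc, zero_add, ← Finsupp.degree_eq_sum, hP d hd]

omit [Fintype σ] [DecidableEq K] in
/-- (copy) `(shear_{j,t} P)(y_j ↦ 1) = Φ_{j,t}(P)`. -/
private theorem flat_shear (j : σ) (t : σ → K) (P : MvPolynomial σ K) :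
    aeval (fun i => if i = j then (1 : MvPolynomial σ K) else X i) (shear j t P) =
      aeval (fun i => if i = j then (1 : MvPolynomial σ K) else X i + C (t i)) P := by
  unfold shear
  rw [← AlgHom.comp_apply, MvPolynomial.comp_aeval]
  have hfun : (fun i => aeval (fun i => if i = j then (1 : MvPolynomial σ K) else X i)
      (if i = j then (X j : MvPolynomial σ K) else X i + C (t i) * X j)) =
      fun i => if i = j then (1 : MvPolynomial σ K) else X i + C (t i) := by
    funext i
    by_cases hij : i = j
    · rw [if_pos hij, if_pos hij, aeval_X, if_pos rfl]
    · rw [if_neg hij, if_neg hij, map_add, map_mul, aeval_X, aeval_X, aeval_C, if_neg hij,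
        if_pos rfl, mul_one, algebraMap_eq]
  rw [hfun]

omit [Fintype σ] [DecidableEq σ] [DecidableEq K] in
/-- (copy) `|E − E_j e_j| + E_j = |E|`. -/
private theorem degree_erase_add_apply (j : σ) (E : σ →₀ ℕ) : (E.erase j).degree + E j = E.degree := by
  conv_rhs => rw [← Finsupp.erase_add_single j E]
  rw [map_add, Finsupp.degree_single]

omit [DecidableEq K] in
/-- (copy) The monomials of the sheared homogeneous `P` are those of `Φ_{j,b}(P)`, same coefficients. -/
private theorem coeff_erase_dehomog_eq_of_mem_support_shear (j : σ) (b : σ → K) (P : MvPolynomial σ K)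
    {o : ℕ} (hP : ∀ d ∈ P.support, d.degree = o) {E : σ →₀ ℕ} (hE : E ∈ (shear j b P).support) :
    coeff (E.erase j) (aeval (fun i => if i = j then (1 : MvPolynomial σ K) else X i + C (b i)) P) =
      coeff E (shear j b P) := by
  rw [← flat_shear]
  exact coeff_erase_flat_of_isHomogeneous j (shear j b P) (degree_eq_of_mem_support_shear j b P hP) hE

omit [DecidableEq K] in
/-- Every monomial of `Φ_{j,b}(P)` comes from a monomial of `shear_{j,b} P` by erasing `y_j`. -/
private theorem exists_mem_support_shear_of_mem_support_dehomog (j : σ) (b : σ → K)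
    (P : MvPolynomial σ K) {m : σ →₀ ℕ}
    (hm : m ∈ (aeval (fun i => if i = j then (1 : MvPolynomial σ K) else X i + C (b i)) P).support) :
    ∃ E ∈ (shear j b P).support, E.erase j = m := by
  classical
  rw [← flat_shear] at hm
  have hsum : aeval (fun i => if i = j then (1 : MvPolynomial σ K) else X i) (shear j b P) =
      ∑ E ∈ (shear j b P).support, monomial (E.erase j) (coeff E (shear j b P)) := by
    conv_lhs => rw [(shear j b P).as_sum, map_sum]
    exact Finset.sum_congr rfl fun E _ => flat_monomial j E _
  rw [hsum] at hm
  obtain ⟨E, hE, -, hEm⟩ := exists_of_mem_support_sum_monomial _ _ _ hm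
  exact ⟨E, hE, hEm⟩

omit [Fintype σ] [DecidableEq σ] [DecidableEq K] in
/-- The initial form has the order of `F`. -/
theorem ordZero_homogeneousComponent_eq (s : State σ K) {o : ℕ} (ho : ordZero s.F = o) :
    ordZero (homogeneousComponent o s.F) = o := by
  obtain ⟨⟨d₀, hd₀, hd₀deg⟩, -⟩ := (ordZero_eq_nat_iff _ _).mp ho
  rw [ordZero_eq_nat_iff]
  refine ⟨⟨d₀, ?_, hd₀deg⟩, fun d hd => ?_⟩
  · rw [coeff_homogeneousComponent, if_pos hd₀deg]; exact hd₀
  · rw [coeff_homogeneousComponent, if_neg (by omega)]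

omit [Fintype σ] [DecidableEq σ] [DecidableEq K] in
/-- Every monomial of the degree-`o` homogeneous component has degree `o`. -/
private theorem support_homogeneousComponent_degree (o : ℕ) (F : MvPolynomial σ K) :
    ∀ d ∈ (homogeneousComponent o F).support, d.degree = o :=
  fun d hd => ((mem_support_homogeneousComponent_iff o F d).mp hd).2

omit [DecidableEq K] in
/-- Layer `0`, coefficients: for `E_j = o − q`, `[y^E] T₀ = [y^{E − E_j e_j}] Φ_{j,b}(In F)`. -/
theorem coeff_pointTransform_layerState_eq (q : ℕ) (j : σ) (b : σ → K) (hbj : b j = 0)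
    (s : State σ K) {o : ℕ} (ho : ordZero s.F = o) (hqo : q ≤ o) {E : σ →₀ ℕ} (hEj : E j = o - q) :
    coeff E (pointTransform q j b (layerState o s)) =
      coeff (E.erase j) (aeval (fun i => if i = j then (1 : MvPolynomial σ K) else X i + C (b i))
        (homogeneousComponent o s.F)) := by
  rw [coeff_pointTransform_of_apply_eq q j b hbj (layerState o s) (ordZero_homogeneousComponent_eq s ho)
    hqo hEj]
  show coeff (E.erase j) (aeval _ (homogeneousComponent o (homogeneousComponent o s.F))) = _
  rw [homogeneousComponent_of_mem (homogeneousComponent_mem o s.F), if_pos rfl]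

omit [Fintype σ] [DecidableEq σ] [DecidableEq K] in
/-- `q`-th powers, layer-0 side: for `E_j = o − q` (`q ≤ o`), `y^E` is a `q`-th power iff `q ∣ o` and
the exponents off `y_j` are divisible by `q`. -/
theorem isPthPowerExponent_iff_of_apply_eq (q : ℕ) (j : σ) {o : ℕ} (hqo : q ≤ o) {E : σ →₀ ℕ}
    (hEj : E j = o - q) : IsPthPowerExponent q E ↔ q ∣ o ∧ ∀ i, q ∣ (E.erase j) i := by
  classical
  rw [isPthPowerExponent_iff]
  constructor
  · intro h
    refine ⟨?_, fun i => ?_⟩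
    · have h1 := h j
      rw [hEj] at h1
      have h2 := Nat.dvd_add h1 (dvd_refl q)
      rwa [Nat.sub_add_cancel hqo] at h2
    · rw [Finsupp.erase_apply]
      split_ifs
      · exact dvd_zero q
      · exact h i
  · rintro ⟨ho, h⟩ i
    by_cases hij : i = j
    · rw [hij, hEj]
      exact Nat.dvd_sub ho (dvd_refl q)
    · have := h i
      rwa [Finsupp.erase_apply, if_neg hij] at this

omit [DecidableEq K] in
/-- `q`-th powers, shear side: for `|E| = o` the same criterion. -/
theorem isPthPowerExponent_iff_of_degree_eq (q : ℕ) (j : σ) {o : ℕ} {E : σ →₀ ℕ}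
    (hEdeg : E.degree = o) : IsPthPowerExponent q E ↔ q ∣ o ∧ ∀ i, q ∣ (E.erase j) i := by
  classical
  rw [isPthPowerExponent_iff]
  have herase := degree_erase_add_apply j E
  constructor
  · intro h
    have h' : ∀ i, q ∣ (E.erase j) i := by
      intro i
      rw [Finsupp.erase_apply]
      split_ifs
      · exact dvd_zero q
      · exact h i
    refine ⟨?_, h'⟩
    rw [← hEdeg, ← herase]
    exact dvd_add (dvd_degree_of_forall_dvd h') (h j)
  · rintro ⟨ho, h⟩ i
    by_cases hij : i = j
    · rw [hij]
      have h1 : q ∣ (E.erase j).degree := dvd_degree_of_forall_dvd h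
      have h2 : E j = o - (E.erase j).degree := by omega
      rw [h2]
      exact Nat.dvd_sub ho h1
    · have := h i
      rwa [Finsupp.erase_apply, if_neg hij] at this

/-- **The layer-0 order off `y_j` modulo `q`-th powers is Hauser–Perlega's `ord^{mod q}_{Q_T}` of the
sheared initial form.** -/
theorem orderAwayFrom_layerZero_eq (q : ℕ) (j : σ) (b : σ → K) (hbj : b j = 0) (s : State σ K)
    {o : ℕ} (ho : ordZero s.F = o) (hqo : q ≤ o) :
    orderAwayFrom j (step q j b (layerState o s)).F =
      pOrderAwayFrom q j (shear j b (homogeneousComponent o s.F)) := by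
  classical
  set P : MvPolynomial σ K := homogeneousComponent o s.F with hPdef
  have hP : ∀ d ∈ P.support, d.degree = o := support_homogeneousComponent_degree o s.F
  unfold pOrderAwayFrom orderAwayFrom
  apply le_antisymm
  · -- every monomial of the cleaned shear gives a monomial of the cleaned layer-0 transform
    refine Finset.le_inf fun E' hE' => ?_
    rw [MvPolynomial.mem_support_iff, coeff_deletePthPowers] at hE'
    by_cases hpth' : IsPthPowerExponent q E'
    · exact absurd (if_pos hpth') hE'
    rw [if_neg hpth'] at hE'
    have hE's : E' ∈ (shear j b P).support := MvPolynomial.mem_support_iff.mpr hE'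
    have hE'deg : E'.degree = o := degree_eq_of_mem_support_shear j b P hP E' hE's
    set m := E'.erase j with hmdef
    have hmj : m j = 0 := by rw [hmdef, Finsupp.erase_same]
    have hmcoeff : coeff m (aeval (fun i => if i = j then (1 : MvPolynomial σ K) else X i + C (b i)) P) ≠ 0 := by
      rw [hmdef, coeff_erase_dehomog_eq_of_mem_support_shear j b P hP hE's]
      exact hE'
    set E : σ →₀ ℕ := m + Finsupp.single j (o - q) with hEdef
    have hEj : E j = o - q := by
      rw [hEdef, Finsupp.add_apply, hmj, Finsupp.single_eq_same, zero_add]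
    have hEm : E.erase j = m := erase_add_single_of_apply_eq_zero hmj _
    have hEsupp : E ∈ (step q j b (layerState o s)).F.support := by
      rw [MvPolynomial.mem_support_iff]
      show coeff E (deletePthPowers q (pointTransform q j b (layerState o s))) ≠ 0
      rw [coeff_deletePthPowers]
      have hnp : ¬ IsPthPowerExponent q E := by
        rw [isPthPowerExponent_iff_of_apply_eq q j hqo hEj, hEm]
        rw [isPthPowerExponent_iff_of_degree_eq q j hE'deg] at hpth'
        exact hpth'
      rw [if_neg hnp, coeff_pointTransform_layerState_eq q j b hbj s ho hqo hEj, hEm]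
      exact hmcoeff
    have h1 := Finset.inf_le (f := fun d : σ →₀ ℕ => ((d.degree - d j : ℕ) : ℕ∞)) hEsupp
    have h2 : E.degree - E j = E'.degree - E' j := by
      have a1 := degree_erase_add_apply j E
      have a2 := degree_erase_add_apply j E'
      rw [hEm, hmdef] at a1
      omega
    simpa [h2] using h1
  · refine Finset.le_inf fun E hE => ?_
    have hEj : E j = o - q := apply_eq_of_mem_support_step_layerState q j b hbj s o hE
    rw [MvPolynomial.mem_support_iff] at hE
    change coeff E (deletePthPowers q (pointTransform q j b (layerState o s))) ≠ 0 at hE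
    rw [coeff_deletePthPowers] at hE
    by_cases hpth : IsPthPowerExponent q E
    · exact absurd (if_pos hpth) hE
    rw [if_neg hpth, coeff_pointTransform_layerState_eq q j b hbj s ho hqo hEj] at hE
    have hm : E.erase j ∈ (aeval (fun i => if i = j then (1 : MvPolynomial σ K) else X i + C (b i)) P).support :=
      MvPolynomial.mem_support_iff.mpr hE
    obtain ⟨E', hE's, hE'm⟩ := exists_mem_support_shear_of_mem_support_dehomog j b P hm
    have hE'deg : E'.degree = o := degree_eq_of_mem_support_shear j b P hP E' hE's
    have hnp' : ¬ IsPthPowerExponent q E' := by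
      rw [isPthPowerExponent_iff_of_degree_eq q j hE'deg, hE'm]
      rw [isPthPowerExponent_iff_of_apply_eq q j hqo hEj] at hpth
      exact hpth
    have hE'supp : E' ∈ (deletePthPowers q (shear j b P)).support := by
      rw [MvPolynomial.mem_support_iff, coeff_deletePthPowers, if_neg hnp']
      exact MvPolynomial.mem_support_iff.mp hE's
    have h1 := Finset.inf_le (f := fun d : σ →₀ ℕ => ((d.degree - d j : ℕ) : ℕ∞)) hE'supp
    have h2 : E'.degree - E' j = E.degree - E j := by
      have a1 := degree_erase_add_apply j E
      have a2 := degree_erase_add_apply j E'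
      rw [hE'm] at a2
      omega
    simpa [h2] using h1

/-- **CLAIM 3 holds:** the layer-0 inequality `shade s + 1 ≤ L_0` is `HauserPerlega2019.Condition4`. -/
theorem layerZeroIsCondition4Claim_holds (q : ℕ) (j : σ) (b : σ → K) (s : State σ K) :
    LayerZeroIsCondition4Claim q j b s := by
  classical
  intro hbj hF hq hr
  have hfin : ordZero s.F ≠ ⊤ := by
    unfold ordZero
    rw [Ne, MvPowerSeries.order_eq_top_iff, MvPolynomial.coe_eq_zero_iff]
    exact hF
  obtain ⟨o, ho⟩ := ENat.ne_top_iff_exists.mp hfin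
  have ho' : ordZero s.F = o := ho.symm
  have hqo : q ≤ o := by
    rw [ho'] at hq
    exact_mod_cast hq
  -- arithmetic of the multiplicities
  obtain ⟨⟨d₀, hd₀, hd₀deg⟩, -⟩ := (ordZero_eq_nat_iff _ _).mp ho'
  have hro : s.r.degree ≤ o :=
    hd₀deg ▸ degree_le_degree_of_le (hr d₀ (MvPolynomial.mem_support_iff.mpr hd₀))
  have hsplit : s.r.degree = ∑ i ∈ lostComponents j b, s.r i + keptDegree j b s := by
    unfold keptDegree
    rw [Finsupp.degree_eq_sum, Finset.sum_add_sum_compl]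
  unfold HauserPerlega2019.Condition4 HauserPerlega2019.ObliqueOrderCondition
    HauserPerlega2019.residualDegree HauserPerlega2019.initialForm layerValue
  rw [layerTransform_eq q j b s ho' 0, Nat.add_zero, orderAwayFrom_layerZero_eq q j b hbj s ho' hqo,
    ho', ENat.toNat_coe, shade_eq_of_ordZero_eq s ho', Nat.cast_zero, zero_add]
  set X := pOrderAwayFrom q j (shear j b (homogeneousComponent o s.F)) with hXdef
  by_cases hX : X = ⊤
  · rw [hX, ENat.top_sub_coe]
    exact ⟨fun _ => WithTop.coe_lt_top _, fun _ => le_top⟩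
  · obtain ⟨x, hx⟩ := ENat.ne_top_iff_exists.mp hX
    rw [← hx, ← ENat.coe_sub]
    constructor
    · intro h
      have h' : o - s.r.degree + 1 ≤ x - keptDegree j b s := by exact_mod_cast h
      exact_mod_cast (show o - ∑ i ∈ lostComponents j b, s.r i < x by omega)
    · intro h
      have h' : o - ∑ i ∈ lostComponents j b, s.r i < x := by exact_mod_cast h
      exact_mod_cast (show o - s.r.degree + 1 ≤ x - keptDegree j b s by omega)

end LayerZero

/-! ### Formal consequences (proved): the numerical content of CLAIM 2 is CLAIM 1 -/

omit [Fintype σ] [DecidableEq σ] [DecidableEq K] in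
/-- The shade of a state with `F ≠ 0` is finite. -/
theorem shade_ne_top (s : State σ K) (hF : s.F ≠ 0) : s.shade ≠ ⊤ := by
  have h1 : ordZero s.F ≠ ⊤ := by
    unfold ordZero
    rw [Ne, MvPowerSeries.order_eq_top_iff, MvPolynomial.coe_eq_zero_iff]
    exact hF
  show ordZero s.F - (s.r.degree : ℕ∞) ≠ ⊤
  exact ne_top_of_le_ne_top h1 tsub_le_self

/-- In `ℕ∞`, for a finite `a`: `a < ⨅ d, L d ↔ ∀ d, a + 1 ≤ L d`. -/
theorem lt_iInf_iff_forall_add_one_le {a : ℕ∞} (ha : a ≠ ⊤) (L : ℕ → ℕ∞) :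
    a < ⨅ d, L d ↔ ∀ d, a + 1 ≤ L d := by
  constructor
  · intro hlt d
    exact (ENat.add_one_le_iff ha).mpr (lt_of_lt_of_le hlt (iInf_le _ d))
  · intro hall
    exact (ENat.add_one_le_iff ha).mp (le_iInf hall)

/-- `KangarooCriterionClaim` is a FORMAL CONSEQUENCE of `LayerFormulaClaim`: once the shade after the
step is the infimum of the layer values, "the shade increases" is "every layer value is at least
`shade s + 1`" (the shade of a state with `F ≠ 0` being finite). So the only unproved content of
CLAIM 2 is CLAIM 1. -/
theorem kangarooCriterionClaim_of_layerFormulaClaim (q : ℕ) (j : σ) (b : σ → K) (s : State σ K)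
    (h : LayerFormulaClaim q j b s) : KangarooCriterionClaim q j b s := by
  intro hb hF hq hr
  have hL : (step q j b s).shade = ⨅ d : ℕ, layerValue q j b s d := h hb hF hq hr
  unfold ShadeIncreases AllLayersOblique
  rw [hL]
  exact lt_iInf_iff_forall_add_one_le (shade_ne_top s hF) _

/-- Conversely-directed bookkeeping: under `LayerFormulaClaim`, the published necessary condition is the
`d = 0` instance of the criterion — if the shade increases then in particular the layer-0 value is at
least `shade s + 1` (which `LayerZeroIsCondition4Claim` identifies with `HauserPerlega2019.Condition4`;
the tree proves that implication directly as `PointBlowup.condition4_of_shadeIncreases`). -/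
theorem layerZero_oblique_of_shadeIncreases (q : ℕ) (j : σ) (b : σ → K) (s : State σ K)
    (h : LayerFormulaClaim q j b s) (hb : b j = 0) (hF : s.F ≠ 0) (hq : (q : ℕ∞) ≤ ordZero s.F)
    (hr : ∀ d ∈ s.F.support, s.r ≤ d) (hinc : ShadeIncreases q j b s) :
    s.shade + 1 ≤ layerValue q j b s 0 :=
  ((kangarooCriterionClaim_of_layerFormulaClaim q j b s h) hb hF hq hr).mp hinc 0


/-- **CLAIM 2 holds: the kangaroo criterion.** Under the walk's hypotheses the shade increases at the
point `b` of the `y_j`-chart IFF every layer value is at least `shade s + 1`. -/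
theorem kangarooCriterionClaim_holds (q : ℕ) (j : σ) (b : σ → K) (s : State σ K) :
    KangarooCriterionClaim q j b s :=
  kangarooCriterionClaim_of_layerFormulaClaim q j b s (layerFormulaClaim_holds q j b s)

end Summit.ResolutionOfSingularities.KangarooAtlas.PointBlowup
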